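import Summits.KontsevichZagierPeriods.KontsevichZagierPeriods.Theorems.HurwitzMicroSectorsHurwitzSectorComplementStubLadderDescentEngine

/-!
# `HurwitzSectorComplement` (stmt-KontsevichZagierPeriods-14341), line `chebyshev-level-deformation`,
# stub S3 `stub_ladderDescent` — part 3: `ζ(even)` at `v₀ = 1`, the T-objects, conclusion (C1)

Def-free. `level4_kit` — the level-4 sector family `σ : ℚ[t] → KZ.IntegralRep w` of the landed kit
`SymReduction.symReduction_kit` together with the two relations of the `ζ(even)`-trick,
`(4^w + 2^w − 2)•[σ(1+t+t²+t³)] ≡ 4^w•[σ((1+t)²)]` and `4^w•[σ(1−t+t²−t³)] ≡ (4^w − 2^{w+1})•[σ(1+t+t²+t³)]`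
(from the distribution polynomials `(1+X+X²+X³) − 4^w X³`, `X + X³ − 2^w X³` of ONE dilation each);
`conc_inv` — `[(0,1)^w, 1/(1+t)] ∈ ℚ·𝔭_w ⇐ [(0,1)^w, 1/(1−t)] ∈ ℚ·𝔭_w`; `step_zeta` — with the engine
S1 as section hypothesis `hT`: `[(0,1)^{N+2}, 1/(1−p)] ∈ ℚ·𝔭 ⇐ 𝔘_{N+1}` by the T-step at
`v₀ = 1 = tan(π/4)` (`T(1,s) = −s/(1+s²) = (s³−s)/(1−s⁴)`), no Euler formula and no irrationality;
`step_T` — `𝔗_{N+2} ⇐ ζ_{N+2}, S2a (hA1), 𝔘_{N+1}` (the peeled term of the T-step is the Fubini product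
`[(0,1)^{N+2}, 1/(1−p)] × [Δ, ∏ω]`); `conc_T` — conclusion (C1) `[(0,1)^{N+2}, T(tan(πj/L), p)] ∈ ℚ·𝔭`.

References: M. Kontsevich, D. Zagier, *Periods* (2001), §1.2; J. Milnor, Enseign. Math. 29 (1983), §1.
-/

noncomputable section

open Set MeasureTheory Polynomial
open scoped BigOperators
open Literature.NumberTheory.Transcendental
open Literature.ModelTheory.ExponentialFields (IsSemialgebraic)

namespace Summit.KontsevichZagierPeriods.Theorems.HurwitzMicroSectorsHurwitzSectorComplement

namespace LadderDescent

/-! ## The level-4 kit and the two dilation relations -/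

/-- **The level-4 sector family with the two dilation relations of the `ζ(even)`-trick.** For `w ≥ 2`
there is `σ : ℚ[t] → KZ.IntegralRep w`, `[σ P] = [(0,1)^w, P(t)/(1−t⁴)]`, absorbing every pinned
sector member, with `(4^w + 2^w − 2)•[σ(1+t+t²+t³)] − 4^w•[σ(1+2t+t²)] ∈ rel` and
`4^w•[σ(1−t+t²−t³)] − (4^w − 2^{w+1})•[σ(1+t+t²+t³)] ∈ rel`: modulo the kernel `K` of the landed kit,
`1+X+X²+X³ ≡ 4^w X³` and `X + X³ ≡ 2^w X³`. [cite: Milnor1983, §1] -/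
theorem level4_kit (w : ℕ) (hw : 2 ≤ w) : ∃ σ : ℚ[X] → KZ.IntegralRep w,
    (∀ P, (σ P).domain = {x | ∀ i, x i ∈ Set.Ioo (0:ℝ) 1}) ∧
    (∀ (P : ℚ[X]) (x : Fin w → ℝ),
      (σ P).integrand x = Polynomial.aeval (∏ i, x i) P / (1 - (∏ i, x i) ^ 4)) ∧
    (∀ (r : KZ.IntegralRep w) (P : ℚ[X]), r.domain = {x | ∀ i, x i ∈ Set.Ioo (0:ℝ) 1} →
      Set.EqOn r.integrand (fun x => Polynomial.aeval (∏ i, x i) P / (1 - (∏ i, x i) ^ 4)) r.domain →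
      KZ.Equivalent r (σ P)) ∧
    (4 ^ w + 2 ^ w - 2) • KZ.of (σ (1 + X + X ^ 2 + X ^ 3)) -
      4 ^ w • KZ.of (σ (1 + 2 * X + X ^ 2)) ∈ KZ.relations ∧
    4 ^ w • KZ.of (σ (1 - X + X ^ 2 - X ^ 3)) -
      (4 ^ w - 2 ^ (w + 1)) • KZ.of (σ (1 + X + X ^ 2 + X ^ 3)) ∈ KZ.relations := by
  obtain ⟨σ, K, hσd, hσi, hσr, hK, hK5, -⟩ := SymReduction.symReduction_kit w 4 hw (by norm_num)
  have H : (∀ P, (σ P).domain = {x | ∀ i, x i ∈ Set.Ioo (0:ℝ) 1}) ∧ ∀ (P : ℚ[X]) (x : Fin w → ℝ),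
      (σ P).integrand x = Polynomial.aeval (∏ i, x i) P / (1 - (∏ i, x i) ^ 4) := ⟨hσd, hσi⟩
  have k1 := hK5 4 1 0 (by norm_num) (by norm_num)
  have k2 := hK5 2 2 1 (by norm_num) (by norm_num)
  have h16 : 16 ≤ 4 ^ w := le_trans (by norm_num) (Nat.pow_le_pow_right (by norm_num) hw)
  have h42 : 2 ^ (w + 1) ≤ 4 ^ w := by
    rw [show (4 : ℕ) = 2 ^ 2 by norm_num, ← pow_mul]
    exact Nat.pow_le_pow_right (by norm_num) (by omega)
  have hc1 : (((4 ^ w + 2 ^ w - 2 : ℕ)) : ℚ) = 4 ^ w + 2 ^ w - 2 := by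
    rw [Nat.cast_sub (le_trans (by norm_num) (h16.trans (Nat.le_add_right _ _))), Nat.cast_add,
      Nat.cast_pow, Nat.cast_pow]
    norm_num
  have hc2 : (((4 ^ w - 2 ^ (w + 1) : ℕ)) : ℚ) = 4 ^ w - 2 ^ (w + 1) := by
    rw [Nat.cast_sub h42, Nat.cast_pow, Nat.cast_pow]
    norm_num
  refine ⟨σ, hσd, hσi, hσr, ?_, ?_⟩
  · have hmem : C (((4 ^ w : ℕ)) : ℚ) * (1 + 2 * X + X ^ 2) -
        C (((4 ^ w + 2 ^ w - 2 : ℕ)) : ℚ) * (1 + X + X ^ 2 + X ^ 3) ∈ K := by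
      have e : C (((4 ^ w : ℕ)) : ℚ) * (1 + 2 * X + X ^ 2) -
          C (((4 ^ w + 2 ^ w - 2 : ℕ)) : ℚ) * (1 + X + X ^ 2 + X ^ 3) =
          ((4 : ℚ) ^ w) • (X ^ 1 * (∑ j ∈ Finset.range 2, X ^ (j * 2)) -
              C (((2 : ℕ) : ℚ) ^ w) * X ^ (2 * (1 + 1) - 1)) -
          ((2 : ℚ) ^ w - 2) • (X ^ 0 * (∑ j ∈ Finset.range 4, X ^ (j * 1)) -
              C (((4 : ℕ) : ℚ) ^ w) * X ^ (4 * (0 + 1) - 1)) := by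
        rw [hc1]
        simp only [Finset.sum_range_succ, Finset.sum_range_zero, smul_eq_C_mul, Nat.cast_pow,
          Nat.cast_ofNat, map_sub, map_add, map_pow, map_ofNat C]
        norm_num
        ring
      rw [e]
      exact K.sub_mem (K.smul_mem _ k2) (K.smul_mem _ k1)
    have hKeq := hK _ _ hmem
    have n1 := sigma_nsmul_mem H (4 ^ w) (1 + 2 * X + X ^ 2)
    have n2 := sigma_nsmul_mem H (4 ^ w + 2 ^ w - 2) (1 + X + X ^ 2 + X ^ 3)
    unfold KZ.Equivalent at hKeq
    convert KZ.relations.sub_mem (KZ.relations.sub_mem n2 hKeq) n1 using 1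
    abel
  · have hmem : C (((4 ^ w : ℕ)) : ℚ) * (1 - X + X ^ 2 - X ^ 3) -
        C (((4 ^ w - 2 ^ (w + 1) : ℕ)) : ℚ) * (1 + X + X ^ 2 + X ^ 3) ∈ K := by
      have e : C (((4 ^ w : ℕ)) : ℚ) * (1 - X + X ^ 2 - X ^ 3) -
          C (((4 ^ w - 2 ^ (w + 1) : ℕ)) : ℚ) * (1 + X + X ^ 2 + X ^ 3) =
          ((2 : ℚ) ^ (w + 1)) • (X ^ 0 * (∑ j ∈ Finset.range 4, X ^ (j * 1)) -
              C (((4 : ℕ) : ℚ) ^ w) * X ^ (4 * (0 + 1) - 1)) -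
          (2 * (4 : ℚ) ^ w) • (X ^ 1 * (∑ j ∈ Finset.range 2, X ^ (j * 2)) -
              C (((2 : ℕ) : ℚ) ^ w) * X ^ (2 * (1 + 1) - 1)) := by
        rw [hc2]
        simp only [Finset.sum_range_succ, Finset.sum_range_zero, smul_eq_C_mul, Nat.cast_pow,
          Nat.cast_ofNat, map_sub, map_mul, map_pow, map_ofNat C]
        norm_num
        ring
      rw [e]
      exact K.sub_mem (K.smul_mem _ k1) (K.smul_mem _ k2)
    have hKeq := hK _ _ hmem
    have n1 := sigma_nsmul_mem H (4 ^ w) (1 - X + X ^ 2 - X ^ 3)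
    have n2 := sigma_nsmul_mem H (4 ^ w - 2 ^ (w + 1)) (1 + X + X ^ 2 + X ^ 3)
    unfold KZ.Equivalent at hKeq
    convert KZ.relations.sub_mem (KZ.relations.add_mem n1 hKeq) n2 using 1
    abel

/-- **`[1/(1+t)] ⇐ [1/(1−t)]`**: on `(0,1)^w` (`w ≥ 2`), `1/(1+t) = σ(1−t+t²−t³)` and
`1/(1−t) = σ(1+t+t²+t³)`; `4^w•[1/(1+t)] ≡ (4^w − 2^{w+1})•[1/(1−t)]` and division by `4^w`.
[cite: KontsevichZagier2001, §1.2] -/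
theorem conc_inv (w : ℕ) (hw : 2 ≤ w)
    (hC3 : ∀ (r : KZ.IntegralRep (w)), r.domain = {x | ∀ i, x i ∈ Set.Ioo (0:ℝ) 1} →
      Set.EqOn r.integrand (fun x => 1 / (1 - ∏ i, x i)) r.domain →
      ∃ q : ℚ, ∀ (s : KZ.IntegralRep (w)), s.domain = {x | ∀ i, x i ∈ Set.Ioo (0:ℝ) 1} →
        Set.EqOn s.integrand (fun x => (q : ℝ) * ∏ i, 2 / (1 + (x i) ^ 2)) s.domain →
        KZ.Equivalent r s) :
    ∀ (r : KZ.IntegralRep (w)), r.domain = {x | ∀ i, x i ∈ Set.Ioo (0:ℝ) 1} →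
      Set.EqOn r.integrand (fun x => 1 / (1 + ∏ i, x i)) r.domain →
      ∃ q : ℚ, ∀ (s : KZ.IntegralRep (w)), s.domain = {x | ∀ i, x i ∈ Set.Ioo (0:ℝ) 1} →
        Set.EqOn s.integrand (fun x => (q : ℝ) * ∏ i, 2 / (1 + (x i) ^ 2)) s.domain →
        KZ.Equivalent r s := by
  intro r hdom hint
  obtain ⟨σ, hσd, hσi, hσr, -, hrel4⟩ := level4_kit w hw
  have hB : ∃ q : ℚ, ∀ (s : KZ.IntegralRep (w)), s.domain = {x | ∀ i, x i ∈ Set.Ioo (0:ℝ) 1} →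
        Set.EqOn s.integrand (fun x => (q : ℝ) * ∏ i, 2 / (1 + (x i) ^ 2)) s.domain →
        KZ.Equivalent (σ (1 + X + X ^ 2 + X ^ 3)) s :=
    hC3 _ (hσd _) fun x hx => by
      have ht := BoxIntegral.prod_mem_Ioo (n := w) (by omega) (hσd _ ▸ hx)
      rw [hσi]
      simp only [map_add, map_pow, map_one, Polynomial.aeval_X]
      generalize ∏ i, x i = t at ht ⊢
      have h4 : (1:ℝ) - t ^ 4 ≠ 0 := SymReduction.one_sub_pow_ne_zero ht (by norm_num)
      have h1 : (1:ℝ) - t ≠ 0 := (sub_pos.2 ht.2).ne'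
      have h1' : (1:ℝ) + t ≠ 0 := by linarith [ht.1]
      rw [div_eq_div_iff] <;> first | assumption | ring
  have h4 : 4 ^ w ≠ 0 := by positivity
  have hB' : ∃ q : ℚ, ∀ (s : KZ.IntegralRep (w)), s.domain = {x | ∀ i, x i ∈ Set.Ioo (0:ℝ) 1} →
        Set.EqOn s.integrand (fun x => (q : ℝ) * ∏ i, 2 / (1 + (x i) ^ 2)) s.domain →
        KZ.Equivalent (σ (1 - X + X ^ 2 - X ^ 3)) s :=
    inQP_of_nsmul h4 hrel4 hB
  have hr : KZ.Equivalent r (σ (1 - X + X ^ 2 - X ^ 3)) :=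
    hσr r _ hdom fun x hx => by
      have ht := BoxIntegral.prod_mem_Ioo (n := w) (by omega) (hdom ▸ hx)
      rw [hint hx]
      simp only [map_add, map_sub, map_pow, map_one, Polynomial.aeval_X]
      generalize ∏ i, x i = t at ht ⊢
      have h4 : (1:ℝ) - t ^ 4 ≠ 0 := SymReduction.one_sub_pow_ne_zero ht (by norm_num)
      have h1 : (1:ℝ) - t ≠ 0 := (sub_pos.2 ht.2).ne'
      have h1' : (1:ℝ) + t ≠ 0 := by linarith [ht.1]
      rw [div_eq_div_iff] <;> first | assumption | ring
  exact inQP_of_equivalent hr hB'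

section Engine

variable (hT :
    (∀ (m k : ℕ) (D : Set (Fin k → ℝ)) (W lam : (Fin k → ℝ) → ℝ) (M Λ : ℝ),
      Literature.ModelTheory.ExponentialFields.IsSemialgebraic ℚ D → Bornology.IsBounded D →
      IsSemialgebraicFunOn ℚ D W → IsSemialgebraicFunOn ℚ D lam →
      (∀ y ∈ D, |W y| ≤ M) → (∀ y ∈ D, 0 < lam y ∧ lam y ≤ Λ) →
      ∀ (r : KZ.IntegralRep (m + 2 + k)),
        r.domain = {z | (∀ i : Fin (m + 2), z (Fin.castAdd k i) ∈ Set.Ioo (0:ℝ) 1) ∧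
          (fun j : Fin k => z (Fin.natAdd (m + 2) j)) ∈ D} →
        Set.EqOn r.integrand (fun z => W (fun j : Fin k => z (Fin.natAdd (m + 2) j)) *
          (((1 - ∏ i : Fin (m + 2), z (Fin.castAdd k i)) -
              (lam (fun j : Fin k => z (Fin.natAdd (m + 2) j))) ^ 2 *
                (1 + ∏ i : Fin (m + 2), z (Fin.castAdd k i))) /
            ((1 - ∏ i : Fin (m + 2), z (Fin.castAdd k i)) ^ 2 +
              (lam (fun j : Fin k => z (Fin.natAdd (m + 2) j))) ^ 2 *
                (1 + ∏ i : Fin (m + 2), z (Fin.castAdd k i)) ^ 2))) r.domain →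
        ∃ (r₁ : KZ.IntegralRep (m + 2 + k)) (r₂ : KZ.IntegralRep (m + 1 + (k + 1))),
          r₁.domain = r.domain ∧
          (r₁.integrand = fun z => W (fun j : Fin k => z (Fin.natAdd (m + 2) j)) /
            (1 - ∏ i : Fin (m + 2), z (Fin.castAdd k i))) ∧
          r₂.domain = {z | (∀ i : Fin (m + 1), z (Fin.castAdd (k + 1) i) ∈ Set.Ioo (0:ℝ) 1) ∧
            (fun j : Fin k => z (Fin.natAdd (m + 1) j.succ)) ∈ D ∧
            0 < z (Fin.natAdd (m + 1) 0) ∧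
            z (Fin.natAdd (m + 1) 0) < lam ((fun j : Fin k => z (Fin.natAdd (m + 1) j.succ)))} ∧
          (r₂.integrand = fun z => W ((fun j : Fin k => z (Fin.natAdd (m + 1) j.succ))) *
            (2 / (1 + (z (Fin.natAdd (m + 1) 0)) ^ 2)) *
            (2 * z (Fin.natAdd (m + 1) 0) /
              ((1 - ∏ i : Fin (m + 1), z (Fin.castAdd (k + 1) i)) ^ 2 +
                (z (Fin.natAdd (m + 1) 0)) ^ 2 * (1 + ∏ i : Fin (m + 1), z (Fin.castAdd (k + 1) i)) ^ 2))) ∧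
          KZ.of r - KZ.of r₁ + KZ.of r₂ ∈ KZ.relations))

variable (hA1 :
    (∀ (a j₀ j₁ L : ℕ), j₀ < j₁ → 2 * j₁ < L → ∀ (r : KZ.IntegralRep a),
      r.domain = {y | (∀ i, Real.tan (Real.pi * j₀ / L) < y i ∧ y i < Real.tan (Real.pi * j₁ / L)) ∧
        (∀ i i' : Fin a, i < i' → y i < y i')} →
      Set.EqOn r.integrand (fun y => ∏ i, 2 / (1 + (y i) ^ 2)) r.domain →
      ∃ q : ℚ, ∀ (s : KZ.IntegralRep a), s.domain = {x | ∀ i, x i ∈ Set.Ioo (0:ℝ) 1} →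
        Set.EqOn s.integrand (fun x => (q : ℝ) * ∏ i, 2 / (1 + (x i) ^ 2)) s.domain →
        KZ.Equivalent r s))

include hT in
/-- **`ζ(even)` by the ladder at `v₀ = 1`**: `[(0,1)^{N+2}, 1/(1−p)] ∈ ℚ·𝔭 ⇐ 𝔘_{N+1}`. The T-step
from the box `[(0,1)^{N+2}, T(1,p)] = [σ(t³ − t)]` (`tan(π/4) = 1`) gives
`[σ(1+2t+t²)] = [σ(1+t+t²+t³)] − [σ(t³−t)] ≡ 𝔘_{N+1,1}(1) ∈ ℚ·𝔭`, and
`(4^w+2^w−2)•[σ(1+t+t²+t³)] ≡ 4^w•[σ(1+2t+t²)]` (`level4_kit`); divide by `4^w + 2^w − 2 ≠ 0`.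
[cite: KontsevichZagier2001, §1.2] -/
theorem step_zeta (N : ℕ)
    (hUU : ∀ (k j L : ℕ), 0 < j → 2 * j < L → ∀ (r : KZ.IntegralRep (N + 1 + (k + 1))),
      r.domain = {z | (∀ i : Fin (N + 1), z (Fin.castAdd (k + 1) i) ∈ Set.Ioo (0:ℝ) 1) ∧
        (∀ i : Fin (k + 1), 0 < z (Fin.natAdd (N + 1) i) ∧ z (Fin.natAdd (N + 1) i) < Real.tan (Real.pi * j / L)) ∧
        (∀ i i' : Fin (k + 1), i < i' → z (Fin.natAdd (N + 1) i) < z (Fin.natAdd (N + 1) i'))} →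
      Set.EqOn r.integrand (fun z => (∏ i : Fin (k + 1), 2 / (1 + (z (Fin.natAdd (N + 1) i)) ^ 2)) *
        (2 * z (Fin.natAdd (N + 1) 0) /
          ((1 - ∏ i : Fin (N + 1), z (Fin.castAdd (k + 1) i)) ^ 2 + (z (Fin.natAdd (N + 1) 0)) ^ 2 * (1 + ∏ i : Fin (N + 1), z (Fin.castAdd (k + 1) i)) ^ 2))) r.domain →
      ∃ q : ℚ, ∀ (s : KZ.IntegralRep (N + 1 + (k + 1))), s.domain = {x | ∀ i, x i ∈ Set.Ioo (0:ℝ) 1} →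
        Set.EqOn s.integrand (fun x => (q : ℝ) * ∏ i, 2 / (1 + (x i) ^ 2)) s.domain →
        KZ.Equivalent r s) :
    ∀ (r : KZ.IntegralRep (N + 2)), r.domain = {x | ∀ i, x i ∈ Set.Ioo (0:ℝ) 1} →
      Set.EqOn r.integrand (fun x => 1 / (1 - ∏ i, x i)) r.domain →
      ∃ q : ℚ, ∀ (s : KZ.IntegralRep (N + 2)), s.domain = {x | ∀ i, x i ∈ Set.Ioo (0:ℝ) 1} →
        Set.EqOn s.integrand (fun x => (q : ℝ) * ∏ i, 2 / (1 + (x i) ^ 2)) s.domain →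
        KZ.Equivalent r s := by
  intro r hdom hint
  obtain ⟨σ, hσd, hσi, hσr, hrel4, -⟩ := level4_kit (N + 2) (by omega)
  have H : (∀ P, (σ P).domain = {x | ∀ i, x i ∈ Set.Ioo (0:ℝ) 1}) ∧ ∀ (P : ℚ[X]) (x : Fin (N + 2) → ℝ),
      (σ P).integrand x = Polynomial.aeval (∏ i, x i) P / (1 - (∏ i, x i) ^ 4) := ⟨hσd, hσi⟩
  have hTA : Set.EqOn (σ (X ^ 3 - X)).integrand (fun x =>
        (((1 - ∏ i, x i) - (Real.tan (Real.pi * (1:ℕ) / (4:ℕ))) ^ 2 * (1 + ∏ i, x i)) /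
          ((1 - ∏ i, x i) ^ 2 + (Real.tan (Real.pi * (1:ℕ) / (4:ℕ))) ^ 2 * (1 + ∏ i, x i) ^ 2))) (σ (X ^ 3 - X)).domain := by
    intro x hx
    have ht := BoxIntegral.prod_mem_Ioo (n := N + 2) (by omega) (hσd _ ▸ hx)
    rw [hσi, tan_pi_one_four]
    simp only [map_sub, map_pow, Polynomial.aeval_X, one_pow, one_mul]
    generalize ∏ i, x i = t at ht ⊢
    have h4 : (1:ℝ) - t ^ 4 ≠ 0 := SymReduction.one_sub_pow_ne_zero ht (by norm_num)
    have h2 : (1 - t) ^ 2 + (1 + t) ^ 2 ≠ (0:ℝ) := by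
      have e : (1 - t) ^ 2 + (1 + t) ^ 2 = (2:ℝ) * (1 + t ^ 2) := by ring
      rw [e]
      positivity
    rw [div_eq_div_iff h4 h2]
    ring
  obtain ⟨r₁, r₂, h1d, h1i, h2d, h2i, hrel⟩ :=
    ladder_T0 hT N 1 4 Nat.one_pos (by norm_num) (σ (X ^ 3 - X)) (hσd _) hTA
  have h2 : ∃ q : ℚ, ∀ (s : KZ.IntegralRep (N + 2)), s.domain = {x | ∀ i, x i ∈ Set.Ioo (0:ℝ) 1} →
        Set.EqOn s.integrand (fun x => (q : ℝ) * ∏ i, 2 / (1 + (x i) ^ 2)) s.domain →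
        KZ.Equivalent r₂ s :=
    inQP_cast (by omega) (hUU 0 1 4 Nat.one_pos (by norm_num) r₂ h2d h2i)
  have h1B : KZ.Equivalent r₁ (σ (1 + X + X ^ 2 + X ^ 3)) :=
    hσr r₁ _ h1d fun x hx => by
      have ht := BoxIntegral.prod_mem_Ioo (n := N + 2) (by omega) (h1d ▸ hx)
      rw [h1i]
      simp only [map_add, map_pow, map_one, Polynomial.aeval_X]
      generalize ∏ i, x i = t at ht ⊢
      have h4 : (1:ℝ) - t ^ 4 ≠ 0 := SymReduction.one_sub_pow_ne_zero ht (by norm_num)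
      have h1 : (1:ℝ) - t ≠ 0 := (sub_pos.2 ht.2).ne'
      have h1' : (1:ℝ) + t ≠ 0 := by linarith [ht.1]
      rw [div_eq_div_iff] <;> first | assumption | ring
  have hadd := sigma_add_mem H (1 + 2 * X + X ^ 2) (X ^ 3 - X)
  have ep : (1 + 2 * X + X ^ 2) + (X ^ 3 - X) = (1 + X + X ^ 2 + X ^ 3 : ℚ[X]) := by ring
  rw [ep] at hadd
  have hp2 : KZ.of (σ (1 + 2 * X + X ^ 2)) - KZ.of r₂ ∈ KZ.relations := by
    unfold KZ.Equivalent at h1B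
    convert KZ.relations.sub_mem (KZ.relations.neg_mem (KZ.relations.add_mem hadd h1B)) hrel
      using 1
    abel
  have key : (4 ^ (N + 2) + 2 ^ (N + 2) - 2) • KZ.of (σ (1 + X + X ^ 2 + X ^ 3)) -
      4 ^ (N + 2) • KZ.of r₂ ∈ KZ.relations := by
    convert KZ.relations.add_mem hrel4 (KZ.relations.nsmul_mem hp2 (4 ^ (N + 2))) using 1
    rw [smul_sub]
    abel
  have h16 : 16 ≤ 4 ^ (N + 2) :=
    le_trans (by norm_num) (Nat.pow_le_pow_right (by norm_num) (by omega : 2 ≤ N + 2))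
  have hn0 : 4 ^ (N + 2) + 2 ^ (N + 2) - 2 ≠ 0 := by
    have := h16.trans (Nat.le_add_right (4 ^ (N + 2)) (2 ^ (N + 2)))
    omega
  have hB : ∃ q : ℚ, ∀ (s : KZ.IntegralRep (N + 2)), s.domain = {x | ∀ i, x i ∈ Set.Ioo (0:ℝ) 1} →
        Set.EqOn s.integrand (fun x => (q : ℝ) * ∏ i, 2 / (1 + (x i) ^ 2)) s.domain →
        KZ.Equivalent (σ (1 + X + X ^ 2 + X ^ 3)) s :=
    inQP_of_nsmul hn0 key h2
  have hr : KZ.Equivalent r (σ (1 + X + X ^ 2 + X ^ 3)) :=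
    hσr r _ hdom fun x hx => by
      have ht := BoxIntegral.prod_mem_Ioo (n := N + 2) (by omega) (hdom ▸ hx)
      rw [hint hx]
      simp only [map_add, map_pow, map_one, Polynomial.aeval_X]
      generalize ∏ i, x i = t at ht ⊢
      have h4 : (1:ℝ) - t ^ 4 ≠ 0 := SymReduction.one_sub_pow_ne_zero ht (by norm_num)
      have h1 : (1:ℝ) - t ≠ 0 := (sub_pos.2 ht.2).ne'
      have h1' : (1:ℝ) + t ≠ 0 := by linarith [ht.1]
      rw [div_eq_div_iff] <;> first | assumption | ring
  exact inQP_of_equivalent hr hB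

include hT hA1 in
/-- **The T-objects**: `𝔗_{N+2,k+1} ⇐ ζ_{N+2}, S2a, 𝔘_{N+1,k+2}` (one T-step of the engine; the peeled
term `[(0,1)^{N+2} × Δ_{k+1}, W/(1−p)]` is pinned-equal to the Fubini product
`[(0,1)^{N+2}, 1/(1−p)] × [Δ_{k+1}, W]`, a rational multiple of `𝔭_{N+2} × 𝔭_{k+1} = 𝔭_{N+k+3}`).
[cite: KontsevichZagier2001, §1.2] -/
theorem step_T (N : ℕ)
    (hC3 : ∀ (r : KZ.IntegralRep (N + 2)), r.domain = {x | ∀ i, x i ∈ Set.Ioo (0:ℝ) 1} →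
      Set.EqOn r.integrand (fun x => 1 / (1 - ∏ i, x i)) r.domain →
      ∃ q : ℚ, ∀ (s : KZ.IntegralRep (N + 2)), s.domain = {x | ∀ i, x i ∈ Set.Ioo (0:ℝ) 1} →
        Set.EqOn s.integrand (fun x => (q : ℝ) * ∏ i, 2 / (1 + (x i) ^ 2)) s.domain →
        KZ.Equivalent r s)
    (hUU : ∀ (k j L : ℕ), 0 < j → 2 * j < L → ∀ (r : KZ.IntegralRep (N + 1 + (k + 1))),
      r.domain = {z | (∀ i : Fin (N + 1), z (Fin.castAdd (k + 1) i) ∈ Set.Ioo (0:ℝ) 1) ∧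
        (∀ i : Fin (k + 1), 0 < z (Fin.natAdd (N + 1) i) ∧ z (Fin.natAdd (N + 1) i) < Real.tan (Real.pi * j / L)) ∧
        (∀ i i' : Fin (k + 1), i < i' → z (Fin.natAdd (N + 1) i) < z (Fin.natAdd (N + 1) i'))} →
      Set.EqOn r.integrand (fun z => (∏ i : Fin (k + 1), 2 / (1 + (z (Fin.natAdd (N + 1) i)) ^ 2)) *
        (2 * z (Fin.natAdd (N + 1) 0) /
          ((1 - ∏ i : Fin (N + 1), z (Fin.castAdd (k + 1) i)) ^ 2 + (z (Fin.natAdd (N + 1) 0)) ^ 2 * (1 + ∏ i : Fin (N + 1), z (Fin.castAdd (k + 1) i)) ^ 2))) r.domain →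
      ∃ q : ℚ, ∀ (s : KZ.IntegralRep (N + 1 + (k + 1))), s.domain = {x | ∀ i, x i ∈ Set.Ioo (0:ℝ) 1} →
        Set.EqOn s.integrand (fun x => (q : ℝ) * ∏ i, 2 / (1 + (x i) ^ 2)) s.domain →
        KZ.Equivalent r s) :
    ∀ (k j L : ℕ), 0 < j → 2 * j < L → ∀ (r : KZ.IntegralRep (N + 2 + (k + 1))),
      r.domain = {z | (∀ i : Fin (N + 2), z (Fin.castAdd (k + 1) i) ∈ Set.Ioo (0:ℝ) 1) ∧
        (∀ i : Fin (k + 1), 0 < z (Fin.natAdd (N + 2) i) ∧ z (Fin.natAdd (N + 2) i) < Real.tan (Real.pi * j / L)) ∧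
        (∀ i i' : Fin (k + 1), i < i' → z (Fin.natAdd (N + 2) i) < z (Fin.natAdd (N + 2) i'))} →
      Set.EqOn r.integrand (fun z => (∏ i : Fin (k + 1), 2 / (1 + (z (Fin.natAdd (N + 2) i)) ^ 2)) *
        (((1 - ∏ i : Fin (N + 2), z (Fin.castAdd (k + 1) i)) - (z (Fin.natAdd (N + 2) 0)) ^ 2 * (1 + ∏ i : Fin (N + 2), z (Fin.castAdd (k + 1) i))) /
          ((1 - ∏ i : Fin (N + 2), z (Fin.castAdd (k + 1) i)) ^ 2 + (z (Fin.natAdd (N + 2) 0)) ^ 2 * (1 + ∏ i : Fin (N + 2), z (Fin.castAdd (k + 1) i)) ^ 2))) r.domain →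
      ∃ q : ℚ, ∀ (s : KZ.IntegralRep (N + 2 + (k + 1))), s.domain = {x | ∀ i, x i ∈ Set.Ioo (0:ℝ) 1} →
        Set.EqOn s.integrand (fun x => (q : ℝ) * ∏ i, 2 / (1 + (x i) ^ 2)) s.domain →
        KZ.Equivalent r s := by
  intro k j L hj hjL r hdom hint
  obtain ⟨r₁, r₂, h1d, h1i, h2d, h2i, hrel⟩ := ladder_T hT N k j L hj hjL r hdom hint
  have h2 := hUU (k + 1) j L hj hjL r₂ h2d h2i
  obtain ⟨-, halg⟩ := tan_pos_and_isAlgebraic hj hjL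
  obtain ⟨b, hbd, hbi⟩ := exists_boxInvRep N
  obtain ⟨c, hcd, hci⟩ := exists_chainRep (k + 1) halg
  have hb := hC3 b hbd fun x _ => congrFun hbi x
  have hc := hA1 (k + 1) 0 j L hj hjL c
    (by rw [hcd, Nat.cast_zero, mul_zero, zero_div, Real.tan_zero]) fun y _ => congrFun hci y
  have h1 : KZ.Equivalent r₁ (b.prod c) := by
    refine KZ.of_sub_of_mem_relations_of_eqOn ?_ fun z _ => ?_
    · rw [KZ.IntegralRep.prod_domain, h1d, hdom]
      ext z
      simp only [KZ.IntegralRep.mem_prodDomain, hbd, hcd, mem_setOf_eq]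
    · rw [KZ.IntegralRep.prod_integrand_eq, KZ.IntegralRep.prodFun_apply, h1i, hbi, hci]
      simp only
      ring
  exact inQP_of_rel hrel (inQP_of_equivalent h1 (inQP_prod hb hc)) (inQP_cast (by omega) h2)

include hT in
/-- **Conclusion (C1)**: `[(0,1)^{N+2}, T(tan(πj/L), p)] ∈ ℚ·𝔭_{N+2} ⇐ ζ_{N+2}, 𝔘_{N+1}` (the first
T-step: `[T] ≡ [1/(1−p)] − 𝔘_{N+1,1}`). [cite: KontsevichZagier2001, §1.2] -/
theorem conc_T (N : ℕ)
    (hC3 : ∀ (r : KZ.IntegralRep (N + 2)), r.domain = {x | ∀ i, x i ∈ Set.Ioo (0:ℝ) 1} →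
      Set.EqOn r.integrand (fun x => 1 / (1 - ∏ i, x i)) r.domain →
      ∃ q : ℚ, ∀ (s : KZ.IntegralRep (N + 2)), s.domain = {x | ∀ i, x i ∈ Set.Ioo (0:ℝ) 1} →
        Set.EqOn s.integrand (fun x => (q : ℝ) * ∏ i, 2 / (1 + (x i) ^ 2)) s.domain →
        KZ.Equivalent r s)
    (hUU : ∀ (k j L : ℕ), 0 < j → 2 * j < L → ∀ (r : KZ.IntegralRep (N + 1 + (k + 1))),
      r.domain = {z | (∀ i : Fin (N + 1), z (Fin.castAdd (k + 1) i) ∈ Set.Ioo (0:ℝ) 1) ∧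
        (∀ i : Fin (k + 1), 0 < z (Fin.natAdd (N + 1) i) ∧ z (Fin.natAdd (N + 1) i) < Real.tan (Real.pi * j / L)) ∧
        (∀ i i' : Fin (k + 1), i < i' → z (Fin.natAdd (N + 1) i) < z (Fin.natAdd (N + 1) i'))} →
      Set.EqOn r.integrand (fun z => (∏ i : Fin (k + 1), 2 / (1 + (z (Fin.natAdd (N + 1) i)) ^ 2)) *
        (2 * z (Fin.natAdd (N + 1) 0) /
          ((1 - ∏ i : Fin (N + 1), z (Fin.castAdd (k + 1) i)) ^ 2 + (z (Fin.natAdd (N + 1) 0)) ^ 2 * (1 + ∏ i : Fin (N + 1), z (Fin.castAdd (k + 1) i)) ^ 2))) r.domain →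
      ∃ q : ℚ, ∀ (s : KZ.IntegralRep (N + 1 + (k + 1))), s.domain = {x | ∀ i, x i ∈ Set.Ioo (0:ℝ) 1} →
        Set.EqOn s.integrand (fun x => (q : ℝ) * ∏ i, 2 / (1 + (x i) ^ 2)) s.domain →
        KZ.Equivalent r s) :
    ∀ (j L : ℕ), 0 < j → 2 * j < L → ∀ (r : KZ.IntegralRep (N + 2)), r.domain = {x | ∀ i, x i ∈ Set.Ioo (0:ℝ) 1} →
      Set.EqOn r.integrand (fun x =>
        (((1 - ∏ i, x i) - (Real.tan (Real.pi * j / L)) ^ 2 * (1 + ∏ i, x i)) /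
          ((1 - ∏ i, x i) ^ 2 + (Real.tan (Real.pi * j / L)) ^ 2 * (1 + ∏ i, x i) ^ 2))) r.domain →
      ∃ q : ℚ, ∀ (s : KZ.IntegralRep (N + 2)), s.domain = {x | ∀ i, x i ∈ Set.Ioo (0:ℝ) 1} →
        Set.EqOn s.integrand (fun x => (q : ℝ) * ∏ i, 2 / (1 + (x i) ^ 2)) s.domain →
        KZ.Equivalent r s := by
  intro j L hj hjL r hdom hint
  obtain ⟨r₁, r₂, h1d, h1i, h2d, h2i, hrel⟩ := ladder_T0 hT N j L hj hjL r hdom hint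
  exact inQP_of_rel hrel (hC3 r₁ h1d fun x _ => congrFun h1i x)
    (inQP_cast (by omega) (hUU 0 j L hj hjL r₂ h2d h2i))

end Engine

end LadderDescent

/-! ## Registered sub-goal -/

/-- **Registered sub-goal `ladderDescent_invOnePlus`** (line `chebyshev-level-deformation`, stub S3):
`[(0,1)^w, 1/(1+t)] ∈ ℚ·𝔭_w` follows from `[(0,1)^w, 1/(1−t)] ∈ ℚ·𝔭_w` (`w ≥ 2`) by the level-4
dilation algebra `4^w•[1/(1+t)] ≡ (4^w − 2^{w+1})•[1/(1−t)]`. [cite: KontsevichZagier2001, §1.2] -/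
theorem ladderDescent_invOnePlus : ∀ (w : ℕ), 2 ≤ w → (∀ (r : KZ.IntegralRep w), r.domain = {x | ∀ i, x i ∈ Set.Ioo (0:ℝ) 1} → Set.EqOn r.integrand (fun x => 1 / (1 - ∏ i, x i)) r.domain → ∃ q : ℚ, ∀ (s : KZ.IntegralRep w), s.domain = {x | ∀ i, x i ∈ Set.Ioo (0:ℝ) 1} → Set.EqOn s.integrand (fun x => (q : ℝ) * ∏ i, 2 / (1 + (x i) ^ 2)) s.domain → KZ.Equivalent r s) → ∀ (r : KZ.IntegralRep w), r.domain = {x | ∀ i, x i ∈ Set.Ioo (0:ℝ) 1} → Set.EqOn r.integrand (fun x => 1 / (1 + ∏ i, x i)) r.domain → ∃ q : ℚ, ∀ (s : KZ.IntegralRep w), s.domain = {x | ∀ i, x i ∈ Set.Ioo (0:ℝ) 1} → Set.EqOn s.integrand (fun x => (q : ℝ) * ∏ i, 2 / (1 + (x i) ^ 2)) s.domain → KZ.Equivalent r s :=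
  fun w hw hC3 => LadderDescent.conc_inv w hw hC3

end Summit.KontsevichZagierPeriods.Theorems.HurwitzMicroSectorsHurwitzSectorComplement

end

namespace Summit.KontsevichZagierPeriods.Theorems.HurwitzMicroSectorsHurwitzSectorComplement.LadderDescent

open Literature.NumberTheory.Transcendental

/-- **The U-step of the descent**: `𝔘_{m+2,k+1} ∈ ℚ·𝔭 ⇐ 𝔗_{m+1,·} ∈ ℚ·𝔭` — one U-step of the engine (`hU`, the
U-half of S1; `ladder_U`) lands on a T-object over `(0,1)^{m+1} × Δ_{k+2}(v₀)`. [cite: KontsevichZagier2001, §1.2] -/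
theorem step_U (hU : (∀ (m k : ℕ) (D : Set (Fin k → ℝ)) (W lam : (Fin k → ℝ) → ℝ) (M Λ : ℝ), Literature.ModelTheory.ExponentialFields.IsSemialgebraic ℚ D → Bornology.IsBounded D → IsSemialgebraicFunOn ℚ D W → IsSemialgebraicFunOn ℚ D lam → (∀ y ∈ D, |W y| ≤ M) → (∀ y ∈ D, 0 < lam y ∧ lam y ≤ Λ) → ∀ (r : KZ.IntegralRep (m + 2 + k)), r.domain = {z | (∀ i : Fin (m + 2), z (Fin.castAdd k i) ∈ Set.Ioo (0:ℝ) 1) ∧ (fun j : Fin k => z (Fin.natAdd (m + 2) j)) ∈ D} → Set.EqOn r.integrand (fun z => W (fun j : Fin k => z (Fin.natAdd (m + 2) j)) * (2 * lam (fun j : Fin k => z (Fin.natAdd (m + 2) j)) / ((1 - ∏ i : Fin (m + 2), z (Fin.castAdd k i)) ^ 2 + (lam (fun j : Fin k => z (Fin.natAdd (m + 2) j))) ^ 2 * (1 + ∏ i : Fin (m + 2), z (Fin.castAdd k i)) ^ 2))) r.domain → ∃ (r₂ : KZ.IntegralRep (m + 1 + (k + 1))), r₂.domain = {z | (∀ i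 : Fin (m + 1), z (Fin.castAdd (k + 1) i) ∈ Set.Ioo (0:ℝ) 1) ∧ (fun j : Fin k => z (Fin.natAdd (m + 1) j.succ)) ∈ D ∧ 0 < z (Fin.natAdd (m + 1) 0) ∧ z (Fin.natAdd (m + 1) 0) < lam ((fun j : Fin k => z (Fin.natAdd (m + 1) j.succ)))} ∧ (r₂.integrand = fun z => W ((fun j : Fin k => z (Fin.natAdd (m + 1) j.succ))) * (2 / (1 + (z (Fin.natAdd (m + 1) 0)) ^ 2)) * (((1 - ∏ i : Fin (m + 1), z (Fin.castAdd (k + 1) i)) - (z (Fin.natAdd (m + 1) 0)) ^ 2 * (1 + ∏ i : Fin (m + 1), z (Fin.castAdd (k + 1) i))) / ((1 - ∏ i : Fin (m + 1), z (Fin.castAdd (k + 1) i)) ^ 2 + (z (Fin.natAdd (m + 1) 0)) ^ 2 * (1 + ∏ i : Fin (m + 1), z (Fin.castAdd (k + 1) i)) ^ 2))) ∧ KZ.of r - KZ.of r₂ ∈ KZ.relations)) (m : ℕ)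
    (hTT : ∀ (k j L : ℕ), 0 < j → 2 * j < L → ∀ (r : KZ.IntegralRep (m + 1 + (k + 1))), r.domain = {z | (∀ i : Fin (m + 1), z (Fin.castAdd (k + 1) i) ∈ Set.Ioo (0:ℝ) 1) ∧ (∀ i : Fin (k + 1), 0 < z (Fin.natAdd (m + 1) i) ∧ z (Fin.natAdd (m + 1) i) < Real.tan (Real.pi * j / L)) ∧ (∀ i i' : Fin (k + 1), i < i' → z (Fin.natAdd (m + 1) i) < z (Fin.natAdd (m + 1) i'))} → Set.EqOn r.integrand (fun z => (∏ i : Fin (k + 1), 2 / (1 + (z (Fin.natAdd (m + 1) i)) ^ 2)) * (((1 - ∏ i : Fin (m + 1), z (Fin.castAdd (k + 1) i)) - (z (Fin.natAdd (m + 1) 0)) ^ 2 * (1 + ∏ i : Fin (m + 1), z (Fin.castAdd (k + 1) i))) / ((1 - ∏ i : Fin (m + 1), z (Fin.castAdd (k + 1) i)) ^ 2 + (z (Fin.natAdd (m + 1) 0)) ^ 2 * (1 + ∏ i : Fin (m + 1), z (Fin.castAdd (k + 1) i)) ^ 2))) r.domain → ∃ q : ℚ, ∀ (s : KZ.IntegralRep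 (m + 1 + (k + 1))), s.domain = {x | ∀ i, x i ∈ Set.Ioo (0:ℝ) 1} → Set.EqOn s.integrand (fun x => (q : ℝ) * ∏ i, 2 / (1 + (x i) ^ 2)) s.domain → KZ.Equivalent r s) :
    ∀ (k j L : ℕ), 0 < j → 2 * j < L → ∀ (r : KZ.IntegralRep (m + 2 + (k + 1))), r.domain = {z | (∀ i : Fin (m + 2), z (Fin.castAdd (k + 1) i) ∈ Set.Ioo (0:ℝ) 1) ∧ (∀ i : Fin (k + 1), 0 < z (Fin.natAdd (m + 2) i) ∧ z (Fin.natAdd (m + 2) i) < Real.tan (Real.pi * j / L)) ∧ (∀ i i' : Fin (k + 1), i < i' → z (Fin.natAdd (m + 2) i) < z (Fin.natAdd (m + 2) i'))} → Set.EqOn r.integrand (fun z => (∏ i : Fin (k + 1), 2 / (1 + (z (Fin.natAdd (m + 2) i)) ^ 2)) * (2 * z (Fin.natAdd (m + 2) 0) / ((1 - ∏ i : Fin (m + 2), z (Fin.castAdd (k + 1) i)) ^ 2 + (z (Fin.natAdd (m + 2) 0)) ^ 2 * (1 + ∏ i : Fin (m + 2), z (Fin.castAdd (k + 1) i)) ^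 2))) r.domain → ∃ q : ℚ, ∀ (s : KZ.IntegralRep (m + 2 + (k + 1))), s.domain = {x | ∀ i, x i ∈ Set.Ioo (0:ℝ) 1} → Set.EqOn s.integrand (fun x => (q : ℝ) * ∏ i, 2 / (1 + (x i) ^ 2)) s.domain → KZ.Equivalent r s := by
  intro k j L hj hjL r hdom hint
  obtain ⟨r₂, h2d, h2i, hrel⟩ := ladder_U hU m k j L hj hjL r hdom hint
  exact inQP_cast (by omega) (inQP_of_equivalent hrel (hTT (k + 1) j L hj hjL r₂ h2d h2i))

end Summit.KontsevichZagierPeriods.Theorems.HurwitzMicroSectorsHurwitzSectorComplement.LadderDescent
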